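import Literature.NumberTheory.ConnesConsani2021.QuasiInnerBlaschkeLimit
import Literature.NumberTheory.ConnesConsani2021.QuasiInnerProductSymbol
import HarnessLib

/-!
# Connes–Consani 2021 (JNT 226), Prop. 3.7: the adjoint kernel, the symmetry `J`, and the assembly

LABEL: RH-FREE (unconditional operator theory on `L²(S¹)`; `bears_on: W-C/W-P` — discharges the typed fact
`QuasiInner.prop_3_7`). WHAT THIS IS NOT: no statement about zeros of `ζ`, no spectral realization, nothing
here bears on the truth of RH.

Contents (theorems only; no new definitions, no new named facts):
* §F `adjoint_hardyOffDiag_kappaPrime_eq_zero_iff`: `((1 − 𝒫)ρ(u_p)𝒫)^* g = 0` iff `⟨ξ_{x_p(n)} | g⟩ = 0`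
  for all `n` (the «offdiag2» expansion tested against `g`, and moment uniqueness).
* §G the unitary `J`, `J e_n = e_{−n−1}`: `J² = 1`, `⟨Jv | Jw⟩ = ⟨v | w⟩`, `J η_{x̄} = ξ_x`, `J(H²) = (H²)^⊥`.
* §H `prop_3_7_iii` («(iii) follows from (ii) using the unitary involution `J`») and the discharge
  `prop_3_7_holds : prop_3_7` (with `prop_3_7_i`, seat t2 g4, and `prop_3_7_ii`).

## References
* [CC21] A. Connes, C. Consani, *Quasi-inner functions and local factors*, J. Number Theory 226 (2021),
  arXiv:2008.10974 — §3, Prop. 3.7 «Blaschke» and its proof (bib key `ConnesConsani2021QuasiInner`).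
-/

noncomputable section

open _root_.MeasureTheory _root_.Complex AddCircle Filter Set Metric
open scoped Real NNReal ENNReal InnerProductSpace Topology ComplexConjugate

namespace Literature.NumberTheory.ConnesConsani2021

namespace QuasiInner

/-! ### §F. The kernel of the adjoint `((1 − 𝒫)ρ(u_p)𝒫)^*` -/

/-- Unconditional summability in `ℂ` is absolute summability. [folklore] -/
private theorem ba_summable_norm_of_summable {ι : Type*} {g : ι → ℂ} (hg : Summable g) :
    Summable fun n => ‖g n‖ := by
  have hre : Summable fun n => |(g n).re| := by
    have h1 : Summable fun n => (g n).re := by simpa using Complex.reCLM.summable hg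
    exact summable_abs_iff.2 h1
  have him : Summable fun n => |(g n).im| := by
    have h1 : Summable fun n => (g n).im := by simpa using Complex.imCLM.summable hg
    exact summable_abs_iff.2 h1
  exact Summable.of_nonneg_of_le (fun n => norm_nonneg _) (fun n => Complex.norm_le_abs_re_add_abs_im (g n))
    (hre.add him)

/-- The weights of «offdiag2» do not vanish. [folklore] -/
private theorem ba_coeff_ne_zero {p : ℕ} (hp : 1 < p) (n : ℤ) :
    (8 * (1 - (p : ℂ)⁻¹) * Real.log p) / (4 * π * n + 3 * I * Real.log p) ^ 2 ≠ 0 := by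
  have hlog : 0 < Real.log p := Real.log_pos (by exact_mod_cast hp)
  have hp1 : (1 - (p : ℂ)⁻¹) ≠ 0 := by
    rw [sub_ne_zero, ne_comm, Ne, inv_eq_one]
    exact_mod_cast (by omega : p ≠ 1)
  have hden : (4 * π * n + 3 * I * Real.log p : ℂ) ≠ 0 := by
    set L : ℝ := Real.log p
    intro h
    have := congrArg Complex.im h
    simp at this
    linarith
  refine div_ne_zero (mul_ne_zero (mul_ne_zero (by norm_num) hp1) ?_) (pow_ne_zero _ hden)
  exact_mod_cast hlog.ne'

/-- RH-FREE. The «offdiag2» expansion tested against a vector on the left: for `g ∈ L²(S¹)` and `k ≥ 0`,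
`⟨g | (1 − 𝒫)ρ(u_p)𝒫 e_k⟩ = Σ_{n∈ℤ} γ_n ⟨g | ξ_{x_p(n)}⟩ x_p(n)^k`.
[cite: ConnesConsani2021QuasiInner, §3 display «offdiag2» (arXiv chunk p0008:L74)] -/
theorem hasSum_inner_hardyOffDiag_kappaPrime_fourierLp_natCast {p : ℕ} (hp : p.Prime)
    (g : Lp ℂ 2 (haarAddCircle (T := (1:ℝ)))) (k : ℕ) :
    HasSum (fun n : ℤ => ((8 * (1 - (p : ℂ)⁻¹) * Real.log p) / (4 * π * n + 3 * I * Real.log p) ^ 2) *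
        ⟪g, xiVec 1 (xPrime p n)⟫_ℂ * xPrime p n ^ k)
      ⟪g, hardyOffDiag 1 (toLpOrZero ∞ haarAddCircle (circleRestrict 1 (kappaPrime p)))
        (fourierLp (T := (1:ℝ)) 2 (k : ℤ))⟫_ℂ := by
  have h := (innerSL ℂ g).hasSum (display_offdiag2_holds p hp (fourierLp (T := (1:ℝ)) 2 (k : ℤ)))
  simp only [innerSL_apply_apply, smul_apply, InnerProductSpace.rankOne_apply, inner_smul_right] at h
  refine h.congr_fun fun n => ?_
  rw [← inner_conj_symm (etaVec 1 (xPrime p n)) (fourierLp (T := (1:ℝ)) 2 (k : ℤ)),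
    inner_fourierLp_natCast_etaVec (T := (1:ℝ)) _ (norm_xPrime_lt_one hp.one_lt _), map_pow,
    Complex.conj_conj]
  ring

/-- RH-FREE. **The kernel of the adjoint** `((1 − 𝒫)ρ(u_p)𝒫)^*` is cut out by the vectors `ξ_{x_p(n)}`: for every
`g ∈ L²(S¹)`, `((1 − 𝒫)ρ(u_p)𝒫)^* g = 0` iff `⟨ξ_{x_p(n)} | g⟩ = 0` for all `n ∈ ℤ`.
[cite: ConnesConsani2021QuasiInner, Prop 3.7 (iii), proof (arXiv chunk p0010:L7–L9)] -/
theorem adjoint_hardyOffDiag_kappaPrime_eq_zero_iff {p : ℕ} (hp : p.Prime)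
    (g : Lp ℂ 2 (haarAddCircle (T := (1:ℝ)))) :
    ContinuousLinearMap.adjoint (hardyOffDiag 1 (toLpOrZero ∞ haarAddCircle (circleRestrict 1 (kappaPrime p)))) g
        = 0 ↔
      ∀ n : ℤ, ⟪xiVec 1 (xPrime p n), g⟫_ℂ = 0 := by
  have hp1 := hp.one_lt
  set A := hardyOffDiag 1 (toLpOrZero ∞ haarAddCircle (circleRestrict 1 (kappaPrime p))) with hA
  constructor
  · intro hg n₀
    set a : ℤ → ℂ := fun n => ((8 * (1 - (p : ℂ)⁻¹) * Real.log p) / (4 * π * n + 3 * I * Real.log p) ^ 2) *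
      ⟪g, xiVec 1 (xPrime p n)⟫_ℂ with ha
    have hmom : ∀ k : ℕ, HasSum (fun n : ℤ => a n * xPrime p n ^ k) 0 := by
      intro k
      have h := hasSum_inner_hardyOffDiag_kappaPrime_fourierLp_natCast hp g k
      rwa [← ContinuousLinearMap.adjoint_inner_left, hg, inner_zero_left] at h
    have hsum : Summable fun n => ‖a n‖ := by
      refine ba_summable_norm_of_summable ?_
      simpa using (hmom 0).summable
    have hzero := eq_zero_of_forall_tsum_mul_pow_eq_zero_of_tendsto_cofinite hsum
      (norm_xPrime_lt_one hp1) (xPrime_ne_zero hp1) (xPrime_injective hp1) (tendsto_xPrime_cofinite hp1)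
      (fun k => (hmom k).tsum_eq)
    have h0 : a n₀ = 0 := by rw [hzero]; rfl
    rcases mul_eq_zero.1 h0 with h1 | h1
    · exact absurd h1 (ba_coeff_ne_zero hp1 n₀)
    · rw [inner_eq_zero_symm]; exact h1
  · intro hz
    -- `⟨A^* g | f⟩ = ⟨g | A f⟩ = Σ_n γ_n ⟨η_n | f⟩ ⟨g | ξ_n⟩ = 0` for every `f`
    have hall : ∀ f : Lp ℂ 2 (haarAddCircle (T := (1:ℝ))), ⟪ContinuousLinearMap.adjoint A g, f⟫_ℂ = 0 := by
      intro f
      rw [ContinuousLinearMap.adjoint_inner_left]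
      have h := (innerSL ℂ g).hasSum (display_offdiag2_holds p hp f)
      simp only [innerSL_apply_apply, smul_apply, InnerProductSpace.rankOne_apply, inner_smul_right] at h
      have hterm : (fun n : ℤ => ((8 * (1 - (p : ℂ)⁻¹) * Real.log p) / (4 * π * n + 3 * I * Real.log p) ^ 2) *
          (⟪etaVec 1 (xPrime p n), f⟫_ℂ * ⟪g, xiVec 1 (xPrime p n)⟫_ℂ)) = fun _ => 0 := by
        funext n
        rw [← inner_conj_symm g, hz n, map_zero, mul_zero, mul_zero]
      rw [hterm] at h
      exact h.unique hasSum_zero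
    exact inner_self_eq_zero.1 (hall _)

/-! ### §G. The unitary `J`, `J e_n = e_{−n−1}` -/

/-- Two bounded operators on `L²(S¹)` agreeing on the Fourier modes are equal. [folklore] -/
private theorem ba_clm_eq_of_fourierLp
    {S R : Lp ℂ 2 (haarAddCircle (T := (1:ℝ))) →L[ℂ] Lp ℂ 2 (haarAddCircle (T := (1:ℝ)))}
    (h : ∀ n : ℤ, S (fourierLp (T := (1:ℝ)) 2 n) = R (fourierLp (T := (1:ℝ)) 2 n)) : S = R := by
  refine ContinuousLinearMap.ext_on (s := Set.range fun n : ℤ => fourierLp (T := (1:ℝ)) 2 n)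
    (Submodule.dense_iff_topologicalClosure_eq_top.2 ?_) ?_
  · have hd := (fourierBasis (T := (1:ℝ))).dense_span
    rwa [coe_fourierBasis] at hd
  · rintro _ ⟨n, rfl⟩
    exact h n

variable {J : Lp ℂ 2 (haarAddCircle (T := (1:ℝ))) →L[ℂ] Lp ℂ 2 (haarAddCircle (T := (1:ℝ)))}

/-- RH-FREE. `J² = 1`. [cite: ConnesConsani2021QuasiInner, Prop 3.7 (iii) (arXiv chunk p0009:L50–L53)] -/
theorem symmJ_comp_self (hJ : ∀ n : ℤ, J (fourierLp (T := (1:ℝ)) 2 n) = fourierLp (T := (1:ℝ)) 2 (-n - 1)) :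
    J.comp J = 1 := by
  refine ba_clm_eq_of_fourierLp fun n => ?_
  show J (J (fourierLp (T := (1:ℝ)) 2 n)) = fourierLp (T := (1:ℝ)) 2 n
  rw [hJ, hJ]
  congr 1
  ring

/-- RH-FREE. `J` is an isometry: `J^*J = 1`. [cite: ConnesConsani2021QuasiInner, Prop 3.7 (iii) (arXiv chunk p0009:L50–L53)] -/
theorem adjoint_symmJ_comp_self
    (hJ : ∀ n : ℤ, J (fourierLp (T := (1:ℝ)) 2 n) = fourierLp (T := (1:ℝ)) 2 (-n - 1)) :
    (ContinuousLinearMap.adjoint J).comp J = 1 := by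
  refine ba_clm_eq_of_fourierLp fun n => ?_
  show ContinuousLinearMap.adjoint J (J (fourierLp (T := (1:ℝ)) 2 n)) = fourierLp (T := (1:ℝ)) 2 n
  rw [hJ]
  refine eq_of_inner_fourierLp_eq 1 fun m => ?_
  rw [ContinuousLinearMap.adjoint_inner_right, hJ,
    orthonormal_iff_ite.1 (orthonormal_fourier (T := (1:ℝ))),
    orthonormal_iff_ite.1 (orthonormal_fourier (T := (1:ℝ)))]
  by_cases hmn : m = n
  · subst hmn; simp
  · rw [if_neg (by omega), if_neg hmn]

/-- RH-FREE. `⟨Jv | Jw⟩ = ⟨v | w⟩`. [cite: ConnesConsani2021QuasiInner, Prop 3.7 (iii) (arXiv chunk p0009:L50–L53)] -/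
theorem inner_symmJ_symmJ (hJ : ∀ n : ℤ, J (fourierLp (T := (1:ℝ)) 2 n) = fourierLp (T := (1:ℝ)) 2 (-n - 1))
    (v w : Lp ℂ 2 (haarAddCircle (T := (1:ℝ)))) : ⟪J v, J w⟫_ℂ = ⟪v, w⟫_ℂ := by
  rw [← ContinuousLinearMap.adjoint_inner_right, ← ContinuousLinearMap.comp_apply, adjoint_symmJ_comp_self hJ]
  rfl

/-- RH-FREE. `J(J v) = v`. [cite: ConnesConsani2021QuasiInner, Prop 3.7 (iii) (arXiv chunk p0009:L50–L53)] -/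
theorem symmJ_symmJ (hJ : ∀ n : ℤ, J (fourierLp (T := (1:ℝ)) 2 n) = fourierLp (T := (1:ℝ)) 2 (-n - 1))
    (v : Lp ℂ 2 (haarAddCircle (T := (1:ℝ)))) : J (J v) = v := by
  rw [← ContinuousLinearMap.comp_apply, symmJ_comp_self hJ]
  rfl

/-- RH-FREE. `J η_{x̄} = ξ_x` (`|x| < 1`): `J` exchanges the two families of Lemma 2.2.
[cite: ConnesConsani2021QuasiInner, Prop 3.7 (iii), proof (arXiv chunk p0010:L7–L9)] -/
theorem symmJ_etaVec_conj (hJ : ∀ n : ℤ, J (fourierLp (T := (1:ℝ)) 2 n) = fourierLp (T := (1:ℝ)) 2 (-n - 1))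
    {x : ℂ} (hx : ‖x‖ < 1) : J (etaVec 1 (conj x)) = xiVec 1 x := by
  have hx' : ‖conj x‖ < 1 := by rwa [RCLike.norm_conj]
  have h1 := J.hasSum (hasSum_etaVec (T := (1:ℝ)) (conj x) hx')
  simp only [Complex.conj_conj, ContinuousLinearMap.map_smul, hJ] at h1
  have h2 := hasSum_xiVec (T := (1:ℝ)) x hx
  refine h1.unique (h2.congr_fun fun k => ?_)
  congr 2
  ring

/-- RH-FREE. `J` maps `(H²)^⊥` into `H²`. [cite: ConnesConsani2021QuasiInner, Prop 3.7 (iii) (arXiv chunk p0009:L50–L53)] -/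
theorem symmJ_mem_hardySpace (hJ : ∀ n : ℤ, J (fourierLp (T := (1:ℝ)) 2 n) = fourierLp (T := (1:ℝ)) 2 (-n - 1))
    {g : Lp ℂ 2 (haarAddCircle (T := (1:ℝ)))} (hg : g ∈ (hardySpace 1)ᗮ) : J g ∈ hardySpace 1 := by
  rw [mem_hardySpace_iff]
  intro m
  have e : fourierLp (T := (1:ℝ)) 2 (-(m + 1 : ℤ)) = J (fourierLp (T := (1:ℝ)) 2 (m : ℤ)) := by
    rw [hJ]; congr 1; ring
  rw [e, inner_symmJ_symmJ hJ]
  rw [Submodule.mem_orthogonal] at hg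
  exact hg _ (fourierLp_natCast_mem_hardySpace 1 m)

/-- RH-FREE. `J` maps `H²` into `(H²)^⊥`. [cite: ConnesConsani2021QuasiInner, Prop 3.7 (iii) (arXiv chunk p0009:L50–L53)] -/
theorem symmJ_mem_hardySpace_orthogonal
    (hJ : ∀ n : ℤ, J (fourierLp (T := (1:ℝ)) 2 n) = fourierLp (T := (1:ℝ)) 2 (-n - 1))
    {f : Lp ℂ 2 (haarAddCircle (T := (1:ℝ)))} (hf : f ∈ hardySpace 1) : J f ∈ (hardySpace 1)ᗮ := by
  -- `⟨e_k | J f⟩ = ⟨J e_{−k−1} | J f⟩ = ⟨e_{−k−1} | f⟩ = 0` for `k ≥ 0`, then density of the modes in `H²`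
  have hmodes : ∀ k : ℕ, ⟪fourierLp (T := (1:ℝ)) 2 (k : ℤ), J f⟫_ℂ = 0 := by
    intro k
    have e : fourierLp (T := (1:ℝ)) 2 (k : ℤ) = J (fourierLp (T := (1:ℝ)) 2 (-(k + 1 : ℤ))) := by
      rw [hJ]; congr 1; ring
    rw [e, inner_symmJ_symmJ hJ]
    exact (mem_hardySpace_iff 1 f).1 hf k
  rw [Submodule.mem_orthogonal]
  intro u hu
  rw [hardySpace_eq_topologicalClosure_span] at hu
  have hle : Submodule.span ℂ (Set.range fun k : ℕ => fourierLp (T := (1:ℝ)) 2 (k : ℤ)) ≤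
      (Submodule.span ℂ {J f})ᗮ := by
    rw [Submodule.span_le]
    rintro _ ⟨k, rfl⟩
    rw [SetLike.mem_coe, Submodule.mem_orthogonal_singleton_iff_inner_left]
    exact hmodes k
  have hu' := (Submodule.topologicalClosure_minimal _ hle (Submodule.isClosed_orthogonal _)) hu
  rw [Submodule.mem_orthogonal_singleton_iff_inner_left] at hu'
  exact hu'

/-! ### §H. Prop 3.7 (iii) and the assembly -/

/-- RH-FREE. **Prop 3.7 (iii)**: `ker(((1 − 𝒫)ρ(u_p)𝒫)^*) ∩ (H²)^⊥ = J K`, `K = ker((1 − 𝒫)ρ(u_p)𝒫) ∩ H²`, for the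
unitary involution `J`, `J e_n = e_{−n−1}` («(iii) follows from (ii) using `J`»: `J η_{x̄} = ξ_x` and
`x̄_p(n) = x_p(−n)` exchange the zero conditions `⟨η_{x_p(n)} | f⟩ = 0` and `⟨ξ_{x_p(n)} | g⟩ = 0`).
[cite: ConnesConsani2021QuasiInner, Prop 3.7 (iii) «Blaschke» (arXiv chunk p0009:L50–L53, proof p0010:L7–L9)] -/
theorem prop_3_7_iii {p : ℕ} (hp : p.Prime)
    (J : Lp ℂ 2 (haarAddCircle (T := (1:ℝ))) →L[ℂ] Lp ℂ 2 (haarAddCircle (T := (1:ℝ))))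
    (hJ : ∀ n : ℤ, J (fourierLp (T := (1:ℝ)) 2 n) = fourierLp (T := (1:ℝ)) 2 (-n - 1)) :
    LinearMap.ker (ContinuousLinearMap.adjoint
        (hardyOffDiag 1 (toLpOrZero ∞ haarAddCircle (circleRestrict 1 (kappaPrime p))))).toLinearMap
        ⊓ (hardySpace 1)ᗮ =
      Submodule.map J.toLinearMap
        (LinearMap.ker (hardyOffDiag 1 (toLpOrZero ∞ haarAddCircle (circleRestrict 1 (kappaPrime p)))).toLinearMap
          ⊓ hardySpace 1) := by
  have hp1 := hp.one_lt
  -- `⟨ξ_{x_p(n)} | J f⟩ = ⟨η_{x_p(−n)} | f⟩`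
  have hswap : ∀ (f : Lp ℂ 2 (haarAddCircle (T := (1:ℝ)))) (n : ℤ),
      ⟪xiVec 1 (xPrime p n), J f⟫_ℂ = ⟪etaVec 1 (xPrime p (-n)), f⟫_ℂ := by
    intro f n
    rw [← symmJ_etaVec_conj hJ (norm_xPrime_lt_one hp1 n), inner_symmJ_symmJ hJ, conj_xPrime]
  apply le_antisymm
  · intro g hg
    rw [Submodule.mem_inf, LinearMap.mem_ker, ContinuousLinearMap.coe_coe] at hg
    obtain ⟨hgA, hgH⟩ := hg
    have hz := (adjoint_hardyOffDiag_kappaPrime_eq_zero_iff hp g).1 hgA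
    rw [Submodule.mem_map]
    refine ⟨J g, (mem_ker_hardyOffDiag_kappaPrime_inf_hardySpace_iff hp _).2
      ⟨symmJ_mem_hardySpace hJ hgH, fun n => ?_⟩, ?_⟩
    · have e := hswap (J g) (-n)
      rw [symmJ_symmJ hJ, neg_neg] at e
      rw [← e]
      exact hz (-n)
    · rw [ContinuousLinearMap.coe_coe, symmJ_symmJ hJ]
  · intro g hg
    rw [Submodule.mem_map] at hg
    obtain ⟨f, hf, rfl⟩ := hg
    obtain ⟨hfH, hfz⟩ := (mem_ker_hardyOffDiag_kappaPrime_inf_hardySpace_iff hp f).1 hf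
    rw [ContinuousLinearMap.coe_coe, Submodule.mem_inf, LinearMap.mem_ker, ContinuousLinearMap.coe_coe]
    refine ⟨(adjoint_hardyOffDiag_kappaPrime_eq_zero_iff hp _).2 fun n => ?_,
      symmJ_mem_hardySpace_orthogonal hJ hfH⟩
    rw [hswap]
    exact hfz (-n)

/-- RH-FREE. **Prop 3.7 «Blaschke» (discharge of the named fact `prop_3_7`)**: (i) the Blaschke product `B_p`
converges on `𝒰` and `κ_p B_p = −p^{(v+1)/(v−1)}` (`prop_3_7_i`, seat t2 g4); (ii) `ker((1 − 𝒫)ρ(u_p)𝒫) ∩ H²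
= B_p H²` (`prop_3_7_ii`); (iii) `ker(((1 − 𝒫)ρ(u_p)𝒫)^*) ∩ (H²)^⊥ = J K` (`prop_3_7_iii`).
[cite: ConnesConsani2021QuasiInner, Prop 3.7 «Blaschke» (arXiv chunk p0009:L46–L53, proof p0009:L54–p0010:L9)] -/
theorem prop_3_7_holds : prop_3_7 := by
  intro p hp
  obtain ⟨h1, h2⟩ := prop_3_7_i p hp
  exact ⟨h1, h2, prop_3_7_ii hp, fun J hJ => prop_3_7_iii hp J hJ⟩

end QuasiInner

end Literature.NumberTheory.ConnesConsani2021
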